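import Summits.NavierStokesRegularity.NavierStokesRegularity.Theorems.ExtremiserTransienceNearExtremalTransiencePerFlowStubGrowthTransfer
import HarnessLib

/-!
# Route `ExtremiserTransience`, crux `NearExtremalTransiencePerFlow` (stmt-NavierStokesRegularity-26567) —
# LINE g9-β «filament selection» rev 5 §2e, stub G′ `stub_growthTransferFlow`: GROWTH TRANSFER AT EVERY RESCALED TIME

`--supports stmt-NavierStokesRegularity-26567`.  Prover seat ns-net-p2 (g6).  THE STATEMENT (`growthTransferFlow`, verbatim the
Prop `GrowthTransferFlow` of the crux workfile `Cruxes/NearExtremalTransiencePerFlow/Lines/filament_selection.lean` rev 5 §2e, with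
`HasLinGrowth A W := ∀ x R, 0 < R → ∫_{B(x,R)}‖W‖² ≤ A R` unfolded): the physical filament budget
`∫_{B(x,r)}|u t'|² ≤ A·ν²·r` (eventually as `t' ↑ T`, all `x`, all `r > 0`) passes, with the SAME constant, to the pointwise limit
`Wτ` at ANY rescaled time `τ < 0` of the translated NS-compatible zoomed FLOWS
`z ↦ (Mb n)⁻¹ • u (t n + (ν/(Mb n)²)(τ − s)) ((ν/Mb n) • (y n + z))`, given the Type-I pinning `(Mb n)²(T − t n)/ν → −s`
(`s < 0`): `∫_{B(x,R)}‖Wτ‖² ≤ A·R` for all `x`, `R > 0`.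

PROOF.  (1) The physical times `t'ₙ = t n + (ν/(Mb n)²)(τ − s)` are eventually in `[0, T)` and tend to `T` from below: with
`aₙ = (Mb n)²(T − t n)/ν → −s > 0` one has `ν/(Mb n)² = (T − t n)/aₙ → 0` and `T − t'ₙ = (ν/(Mb n)²)(aₙ + s − τ) > 0`
eventually (`aₙ + s → 0`, `−τ > 0`); so the budget holds at `t'ₙ` eventually, and `A ≥ 0` (the budget at one late time).
(2) The budget is invariant under the zoom (landed `ballEnergy_zoom_le`, stub G): `∫_{B(x,R)}‖zoomₙ‖² ≤ A R` eventually.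
(3) FATOU on the ball (`lintegral_liminf_le'`; no height bound is needed — the critic's remark on G): the pointwise limit obeys
`∫⁻_{B(x,R)} ‖Wτ‖² ≤ A R`, and `Wτ`, a pointwise limit of continuous fields, is measurable, so the Bochner integral agrees.
Elementary; nothing about Navier–Stokes is used beyond the form of the zoom.  No summit is proved by a line; crux 26567 and NS
regularity stay OPEN. [folklore]
-/

noncomputable section

open MeasureTheory Filter Set Metric Function Topology
open scoped Topology ENNReal
open Literature.Analysis.FluidPDE

namespace Summit.NavierStokesRegularity.NavierStokesRegularity.Theorems

set_option linter.dupNamespace false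

namespace NearExtremalTransiencePerFlow.FilamentSelection

/-- **Fatou on a ball for pointwise limits of continuous fields.**  If continuous fields `v k` satisfy
`∫_{B(x,R)}‖v k‖² ≤ b` and converge pointwise to `W`, then `∫_{B(x,R)}‖W‖² ≤ b` (`0 ≤ b`). [folklore] -/
theorem setIntegral_ball_normSq_le_of_tendsto {v : ℕ → EuclideanSpace ℝ (Fin 3) → EuclideanSpace ℝ (Fin 3)}
    {W : EuclideanSpace ℝ (Fin 3) → EuclideanSpace ℝ (Fin 3)} {x : EuclideanSpace ℝ (Fin 3)} {R b : ℝ} (hb : 0 ≤ b)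
    (hv : ∀ k, Continuous (v k)) (hle : ∀ k, ∫ z in ball x R, ‖v k z‖ ^ 2 ≤ b)
    (hlim : ∀ z, Tendsto (fun k => v k z) atTop (𝓝 (W z))) :
    ∫ z in ball x R, ‖W z‖ ^ 2 ≤ b := by
  -- the `ℝ≥0∞`-valued densities
  set g : ℕ → EuclideanSpace ℝ (Fin 3) → ℝ≥0∞ := fun k z => ENNReal.ofReal (‖v k z‖ ^ 2) with hg
  have hgm : ∀ k, AEMeasurable (g k) (volume.restrict (ball x R)) := fun k =>
    (ENNReal.measurable_ofReal.comp ((hv k).norm.pow 2).measurable).aemeasurable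
  -- each `v k`: the Bochner bound is a bound on the lower integral
  have hgk : ∀ k, ∫⁻ z in ball x R, g k z ≤ ENNReal.ofReal b := by
    intro k
    have hint : IntegrableOn (fun z => ‖v k z‖ ^ 2) (ball x R) :=
      (((hv k).norm.pow 2).continuousOn.integrableOn_compact (isCompact_closedBall x R)).mono_set
        ball_subset_closedBall
    rw [hg]
    simp only
    rw [← ofReal_integral_eq_lintegral_ofReal hint (Eventually.of_forall fun z => by positivity)]
    exact ENNReal.ofReal_le_ofReal (hle k)
  -- pointwise convergence of the densities
  have hglim : ∀ z, Tendsto (fun k => g k z) atTop (𝓝 (ENNReal.ofReal (‖W z‖ ^ 2))) := fun z =>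
    ENNReal.tendsto_ofReal (((hlim z).norm).pow 2)
  -- Fatou
  have hfatou : ∫⁻ z in ball x R, ENNReal.ofReal (‖W z‖ ^ 2) ≤ ENNReal.ofReal b := by
    have h1 : (fun z => ENNReal.ofReal (‖W z‖ ^ 2)) = fun z => liminf (fun k => g k z) atTop := by
      funext z; exact ((hglim z).liminf_eq).symm
    rw [h1]
    refine (lintegral_liminf_le' hgm).trans ?_
    exact liminf_le_of_frequently_le' (Eventually.of_forall hgk).frequently
  -- measurability of the limit and conversion back to the Bochner integral
  have hWm : AEStronglyMeasurable W (volume.restrict (ball x R)) :=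
    aestronglyMeasurable_of_tendsto_ae atTop (fun k => (hv k).aestronglyMeasurable) (ae_of_all _ hlim)
  have hfm : AEStronglyMeasurable (fun z => ‖W z‖ ^ 2) (volume.restrict (ball x R)) := (hWm.norm.pow 2)
  have hfin : HasFiniteIntegral (fun z => ‖W z‖ ^ 2) (volume.restrict (ball x R)) := by
    rw [hasFiniteIntegral_iff_enorm]
    have h2 : (fun z => ‖‖W z‖ ^ 2‖ₑ) = fun z => ENNReal.ofReal (‖W z‖ ^ 2) := by
      funext z; exact Real.enorm_eq_ofReal (by positivity)
    rw [h2]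
    exact hfatou.trans_lt ENNReal.ofReal_lt_top
  have hint : IntegrableOn (fun z => ‖W z‖ ^ 2) (ball x R) := ⟨hfm, hfin⟩
  rw [integral_eq_lintegral_of_nonneg_ae (Eventually.of_forall fun z => by positivity) hfm]
  exact ENNReal.toReal_le_of_le_ofReal hb hfatou

/-- **G′ `stub_growthTransferFlow` — GROWTH TRANSFER AT EVERY RESCALED TIME** (verbatim the Prop `GrowthTransferFlow` of
`Cruxes/NearExtremalTransiencePerFlow/Lines/filament_selection.lean` rev 5 §2e, with `HasLinGrowth` unfolded).  The physical budget
`∫_{B(x,r)}|u t'|² ≤ A·ν²·r` (eventually before `T`) passes to the pointwise limit at rescaled time `τ < 0` of the translated zoomed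
flows `z ↦ (Mb n)⁻¹ • u (t n + (ν/(Mb n)²)(τ − s)) ((ν/Mb n) • (y n + z))` with the SAME constant, given the pinning
`(Mb n)²(T − t n)/ν → −s`: the physical times are eventually late and `< T`, the zoom is budget-invariant (`ballEnergy_zoom_le`), and
Fatou on each ball. [folklore] -/
theorem growthTransferFlow :
    ∀ (ν A T : ℝ) (u : ℝ → EuclideanSpace ℝ (Fin 3) → EuclideanSpace ℝ (Fin 3)) (t Mb : ℕ → ℝ)
      (y : ℕ → EuclideanSpace ℝ (Fin 3)) (s τ : ℝ) (Wτ : EuclideanSpace ℝ (Fin 3) → EuclideanSpace ℝ (Fin 3)),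
    0 < ν → 0 < T → (∀ n, 0 < Mb n) → (∀ n, t n < T) → Tendsto t atTop (𝓝 T) →
    (∀ t' ∈ Set.Ico 0 T, Continuous (u t')) →
    (∀ᶠ t' in 𝓝[<] T, ∀ (x : EuclideanSpace ℝ (Fin 3)) (r : ℝ), 0 < r →
      ∫ z in Metric.ball x r, ‖u t' z‖ ^ 2 ≤ A * ν ^ 2 * r) →
    s < 0 → Tendsto (fun n => Mb n ^ 2 * (T - t n) / ν) atTop (𝓝 (-s)) → τ < 0 →
    (∀ z : EuclideanSpace ℝ (Fin 3), Tendsto (fun n => (Mb n)⁻¹ • u (t n + ν / Mb n ^ 2 * (τ - s)) ((ν / Mb n) • (y n + z)))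
      atTop (𝓝 (Wτ z))) →
    ∀ (x : EuclideanSpace ℝ (Fin 3)) (R : ℝ), 0 < R → ∫ z in Metric.ball x R, ‖Wτ z‖ ^ 2 ≤ A * R := by
  intro ν A T u t Mb y s τ Wτ hν hT hMb htT htlim hcont hbudget hs hpin hτ hlim x R hR
  -- the physical times of the zoomed flows at rescaled time `τ`
  set t' : ℕ → ℝ := fun n => t n + ν / Mb n ^ 2 * (τ - s) with ht'
  -- `aₙ = Mb² (T − tₙ)/ν > 0` and `ν / Mb² = (T − tₙ)/aₙ`
  have ha_pos : ∀ n, 0 < Mb n ^ 2 * (T - t n) / ν := fun n =>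
    div_pos (mul_pos (pow_pos (hMb n) 2) (sub_pos.2 (htT n))) hν
  have hνMb : ∀ n, ν / Mb n ^ 2 = (T - t n) / (Mb n ^ 2 * (T - t n) / ν) := fun n => by
    have h1 : (Mb n) ^ 2 ≠ 0 := pow_ne_zero 2 (hMb n).ne'
    have h2 : T - t n ≠ 0 := (sub_pos.2 (htT n)).ne'
    field_simp
  -- `ν / Mb² → 0`
  have hsub : Tendsto (fun n => T - t n) atTop (𝓝 0) := by
    have h := (tendsto_const_nhds (x := T)).sub htlim
    rw [sub_self] at h
    exact h
  have hνMb0 : Tendsto (fun n => ν / Mb n ^ 2) atTop (𝓝 0) := by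
    have h := hsub.div hpin (neg_ne_zero.2 hs.ne)
    rw [zero_div] at h
    refine h.congr' (Eventually.of_forall fun n => (hνMb n).symm)
  -- `t'ₙ → T`
  have ht'lim : Tendsto t' atTop (𝓝 T) := by
    have h := htlim.add (hνMb0.mul_const (τ - s))
    rw [zero_mul, add_zero] at h
    exact h
  -- `t'ₙ < T` eventually: `T − t'ₙ = (ν/Mb²)(aₙ + s − τ)` with `aₙ + s → 0`, `−τ > 0`
  have ht'lt : ∀ᶠ n in atTop, t' n < T := by
    have h1 : Tendsto (fun n => Mb n ^ 2 * (T - t n) / ν + s - τ) atTop (𝓝 (-s + s - τ)) :=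
      (hpin.add_const s).sub_const τ
    have h2 : (0 : ℝ) < -s + s - τ := by linarith
    filter_upwards [h1.eventually (lt_mem_nhds h2)] with n hn
    have h3 : T - t' n = ν / Mb n ^ 2 * (Mb n ^ 2 * (T - t n) / ν + s - τ) := by
      have h4 : (Mb n) ^ 2 ≠ 0 := pow_ne_zero 2 (hMb n).ne'
      have h5 : Mb n ≠ 0 := (hMb n).ne'
      have h6 : ν / Mb n ^ 2 * (Mb n ^ 2 * (T - t n) / ν) = T - t n := by
        field_simp
      rw [show ν / Mb n ^ 2 * (Mb n ^ 2 * (T - t n) / ν + s - τ)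
          = ν / Mb n ^ 2 * (Mb n ^ 2 * (T - t n) / ν) + ν / Mb n ^ 2 * (s - τ) by ring, h6, ht']
      ring
    have h5 : 0 < T - t' n := by
      rw [h3]; exact mul_pos (div_pos hν (pow_pos (hMb n) 2)) hn
    linarith
  -- `0 ≤ t'ₙ` eventually
  have ht'ge : ∀ᶠ n in atTop, 0 ≤ t' n := ht'lim.eventually (eventually_ge_nhds hT)
  -- the budget holds at `t'ₙ` eventually
  have ht'W : Tendsto t' atTop (𝓝[<] T) := tendsto_nhdsWithin_iff.2 ⟨ht'lim, ht'lt⟩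
  have hbud : ∀ᶠ n in atTop, ∀ (x : EuclideanSpace ℝ (Fin 3)) (r : ℝ), 0 < r →
      ∫ z in Metric.ball x r, ‖u (t' n) z‖ ^ 2 ≤ A * ν ^ 2 * r := ht'W.eventually hbudget
  -- `A ≥ 0`: the budget at one late time
  have hA : 0 ≤ A := by
    obtain ⟨t₀, ht₀⟩ := hbudget.exists
    have h1 := ht₀ 0 1 one_pos
    have h2 : (0 : ℝ) ≤ ∫ z in Metric.ball (0 : EuclideanSpace ℝ (Fin 3)) 1, ‖u t₀ z‖ ^ 2 :=
      integral_nonneg fun z => by positivity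
    have h3 : 0 ≤ A * ν ^ 2 := by nlinarith
    exact nonneg_of_mul_nonneg_left h3 (pow_pos hν 2)
  -- pass to the tail where everything holds
  obtain ⟨N₀, hN₀⟩ := (ht'lt.and (ht'ge.and hbud)).exists_forall_of_atTop
  set v : ℕ → EuclideanSpace ℝ (Fin 3) → EuclideanSpace ℝ (Fin 3) :=
    fun k z => (Mb (k + N₀))⁻¹ • u (t' (k + N₀)) ((ν / Mb (k + N₀)) • (y (k + N₀) + z)) with hv
  have hvcont : ∀ k, Continuous (v k) := by
    intro k
    obtain ⟨h1, h2, -⟩ := hN₀ (k + N₀) (Nat.le_add_left _ _)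
    have hu : Continuous (u (t' (k + N₀))) := hcont _ ⟨h2, h1⟩
    show Continuous (fun z : EuclideanSpace ℝ (Fin 3) =>
      (Mb (k + N₀))⁻¹ • u (t' (k + N₀)) ((ν / Mb (k + N₀)) • (y (k + N₀) + z)))
    fun_prop
  have hvle : ∀ k, ∫ z in ball x R, ‖v k z‖ ^ 2 ≤ A * R := by
    intro k
    obtain ⟨-, -, h3⟩ := hN₀ (k + N₀) (Nat.le_add_left _ _)
    exact ballEnergy_zoom_le hν (hMb _) h3 (y (k + N₀)) x hR
  have hvlim : ∀ z, Tendsto (fun k => v k z) atTop (𝓝 (Wτ z)) := fun z =>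
    (hlim z).comp (tendsto_add_atTop_nat N₀)
  exact setIntegral_ball_normSq_le_of_tendsto (mul_nonneg hA hR.le) hvcont hvle hvlim

end NearExtremalTransiencePerFlow.FilamentSelection

end Summit.NavierStokesRegularity.NavierStokesRegularity.Theorems

end
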